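import Mathlib
import Summits.Ventures.PercRepro2.V2SP
import Summits.Ventures.PercRepro2.Tail2DCount
import Summits.Ventures.PercRepro2.Tail2DThreePoint
import Summits.Ventures.PercRepro2.Tail2DThreePointComm
import Summits.Ventures.PercRepro2.Tail2DFlowTwo
import Summits.Ventures.PercRepro2.Tail2DTransport

/-!
# The transport step on the first WIDE cube: `(P(e²) ∧ P(e⁴))` in parallel (seat mine-b, cell pub-perc-repro2)

`wb = P(e²) ∧ P(e⁴)` (a bundle of two and a bundle of four free edges in series) has max-flow `2` and flow
counts `(11, 28, 11, 6, 6, 2)` at `(2,0), (1,1), (0,2), (1,0), (0,1), (0,0)`.  It VIOLATES the level minor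
of the flow-two step (`n₁₀ n₀₁ = 36 < n₁₁ n₀₀ = 56`) — the first of the wide series–parallel laws — but
satisfies the transport hypotheses of `Tail2DTransport.lean` (all checked by `decide` on the 64
configurations).  Hence every pattern of the M♮ class stays in the class under parallel composition with
`wb` (`MTailPat.par_wb`), e.g. the 12-edge network `wb ∗ wb` (max-flow 4) has an M♮-concave counting
tail (`mtail_wb_par_wb`).
-/

namespace Summit.Ventures.PercRepro2.Tail2D

open V2Closure

/-- the network `P(e²) ∧ P(e⁴)`: a bundle of two and a bundle of four free edges in series -/
def wb : V2Closure.SP := .ser (.par .free .free) (.par (.par (.par .free .free) .free) .free)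

/-- `wb` has max-flow `≤ 2` -/
theorem wb_flowLeTwo : FlowLeTwo wb := by
  unfold FlowLeTwo wb
  rintro ⟨⟨a1, a2⟩, b⟩
  cases a1 <;> cases a2 <;> simp [SP.rLab, SP.bLab, V2Closure.serR, V2Closure.serB, V2Closure.parR, V2Closure.parB] <;> omega

/-- the flow counts of `wb`: `n₀₀ = 2, n₁₀ = n₀₁ = 6, n₂₀ = n₀₂ = 11, n₁₁ = 28` -/
theorem wb_counts : flowCount wb 0 0 = 2 ∧ flowCount wb 1 0 = 6 ∧ flowCount wb 0 1 = 6 ∧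
    flowCount wb 2 0 = 11 ∧ flowCount wb 1 1 = 28 ∧ flowCount wb 0 2 = 11 := by
  unfold flowCount wb; decide

/-- `wb` violates the level minor of the flow-two step: `n₁₀ n₀₁ = 36 < 56 = n₁₁ n₀₀` -/
theorem wb_not_levelMinor : ¬ flowCount wb 0 0 * flowCount wb 1 1 ≤ flowCount wb 1 0 * flowCount wb 0 1 := by
  rw [wb_counts.1, wb_counts.2.1, wb_counts.2.2.1, wb_counts.2.2.2.2.1]; norm_num

/-- `wb` attains the flows `(2,0)`, `(1,1)` and `(0,2)` -/
theorem wb_top : (∃ y : wb.Conf, wb.rLab y = 2 ∧ wb.bLab y = 0) ∧ (∃ y : wb.Conf, wb.rLab y = 1 ∧ wb.bLab y = 1)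
    ∧ (∃ y : wb.Conf, wb.rLab y = 0 ∧ wb.bLab y = 2) :=
  ⟨⟨((false, false), (((false, false), false), false)), by decide⟩,
    ⟨((false, true), (((false, true), false), false)), by decide⟩,
    ⟨((true, true), (((true, true), true), true)), by decide⟩⟩

/-- parallel composition with `wb` keeps the M♮ class (either side) -/
theorem MTailPat.par_wb {s : V2Closure.SP} {L : ℤ} (hs : MTailPat s L) :
    MTailPat (.par s wb) (L + 2) ∧ MTailPat (.par wb s) (L + 2) := by
  obtain ⟨c00, c10, c01, c20, c11, c02⟩ := wb_counts
  refine MTailPat.par_flow2' hs wb wb_flowLeTwo wb_top.1 wb_top.2.1 wb_top.2.2 ?_ ?_ ?_ ?_ ?_ ?_ ?_ ?_ ?_ <;>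
    simp only [c00, c10, c01, c20, c11, c02] <;> norm_num

/-- `wb` itself is in the class (it is `Good`: series of two bundle-parallel terms) -/
theorem mtail_wb : MTailPat wb 2 := by
  have e1 : Good (.par .free .free) (1 + 1) :=
    Good.par .free Good.free flowLeOne_free ⟨false, by decide⟩ ⟨true, by decide⟩
  have e2 : Good (.par (.par .free .free) .free) (1 + 1 + 1) :=
    Good.par .free e1 flowLeOne_free ⟨false, by decide⟩ ⟨true, by decide⟩
  have e3 : Good (.par (.par (.par .free .free) .free) .free) (1 + 1 + 1 + 1) :=
    Good.par .free e2 flowLeOne_free ⟨false, by decide⟩ ⟨true, by decide⟩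
  have h : Good wb (min (1 + 1) (1 + 1 + 1 + 1)) := Good.ser e1 e3
  simpa using MTailPat.of_good h

/-- **the cube of `(P(e²) ∧ P(e⁴)) ∗ (P(e²) ∧ P(e⁴))`** (12 free edges, max-flow 4) has an M♮-concave
counting tail of level 4 -/
theorem mtail_wb_par_wb : IsMTail (cnt (.par wb wb)) 4 := by
  have := (MTailPat.par_wb mtail_wb).1
  simpa [MTailPat] using this

end Summit.Ventures.PercRepro2.Tail2D
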